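import Mathlib

/-!
# Crux `HodgeAbelianVarieties` (stmt-HodgeConjecture-1333), line `cm-pivot-andre` — stub `exists_nat_injective_add_mul` (W9)

A generic natural shift separates finitely many affine-linear functions: if the pairs
`(a i, b i)`, `i ∈ I` (`I` finite), are pairwise distinct, then for some `t : ℕ` the values
`a i + t * b i` are pairwise distinct. For each ordered pair `i ≠ j` the set of bad `t`
(those with `a i + t * b i = a j + t * b j`) has at most one element: if `b i = b j` it is empty
(as then `a i ≠ a j`), and otherwise `t` is forced to be `(a j - a i) / (b i - b j)`. So the bad set
is finite and any natural number outside it works.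

In the lead's André construction this picks `t` so that `diag ψ + t • θ` has `2 dim` distinct
eigenvalues `μ_l + t ρ_s`.
-/

set_option linter.dupNamespace false

noncomputable section

namespace Summit.HodgeConjecture.HodgeConjecture.Theorems.HodgeAbelianVarieties.CMPivotAndre

/-- For fixed `i, j` with `(a i, b i) ≠ (a j, b j)`, at most one natural `t` satisfies
`a i + t * b i = a j + t * b j`. [folklore] -/
theorem subsingleton_setOf_add_natCast_mul_eq {I : Type} (a b : I → ℂ) {i j : I}
    (h : a i ≠ a j ∨ b i ≠ b j) :
    ({t : ℕ | a i + (t : ℂ) * b i = a j + (t : ℂ) * b j} : Set ℕ).Subsingleton := by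
  intro t ht t' ht'
  simp only [Set.mem_setOf_eq] at ht ht'
  have hb : b i ≠ b j := by
    rcases h with h | h
    · intro hbij
      rw [hbij] at ht
      exact h (add_right_cancel ht)
    · exact h
  have hmul : ((t : ℂ) - (t' : ℂ)) * (b i - b j) = 0 := by linear_combination ht - ht'
  rcases mul_eq_zero.mp hmul with h0 | h0
  · exact_mod_cast sub_eq_zero.mp h0
  · exact absurd (sub_eq_zero.mp h0) hb

/-- **Stub W9 of line `cm-pivot-andre` — generic natural shift.** If `I` is finite and the pairs
`(a i, b i)` are pairwise distinct, then for some natural number `t` the map `i ↦ a i + t * b i` is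
injective: the set of bad `t` is contained in the finite union, over the ordered pairs `i ≠ j`, of
the sets `{t | a i + t * b i = a j + t * b j}`, each of which has at most one element; `ℕ` being
infinite, some `t` avoids it. [folklore] -/
theorem exists_nat_injective_add_mul : ∀ {I : Type} [Fintype I] (a b : I → ℂ), (∀ i j, i ≠ j → a i ≠ a j ∨ b i ≠ b j) → ∃ t : ℕ, Function.Injective fun i => a i + (t : ℂ) * b i := by
  intro I _ a b hab
  -- the set of bad shifts is finite
  have hfin : ({t : ℕ | ∃ i j, i ≠ j ∧ a i + (t : ℂ) * b i = a j + (t : ℂ) * b j} : Set ℕ).Finite := by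
    refine Set.Finite.subset (Set.finite_iUnion fun i : I => Set.finite_iUnion fun j : I =>
      (Set.Subsingleton.finite (s := {t : ℕ | i ≠ j ∧ a i + (t : ℂ) * b i = a j + (t : ℂ) * b j})
        ?_)) ?_
    · intro t ht t' ht'
      exact subsingleton_setOf_add_natCast_mul_eq a b (hab i j ht.1) ht.2 ht'.2
    · intro t ht
      simp only [Set.mem_setOf_eq, Set.mem_iUnion] at ht ⊢
      exact ht
  obtain ⟨t, ht⟩ := hfin.exists_notMem
  refine ⟨t, fun i j hij => ?_⟩
  by_contra hne
  exact ht ⟨i, j, hne, hij⟩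

end Summit.HodgeConjecture.HodgeConjecture.Theorems.HodgeAbelianVarieties.CMPivotAndre
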